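import Summits.QuantumFields.QCD.Theorems.QuarksAsStableActionSmallHoppingDiamagnetismWords

/-!
# Small-hopping diamagnetism (stmt-QuantumFields-9738): the antiperiodic `U(3)` lift

Helper file for the support item `SmallHoppingDiamagnetism` of route `QuarksAsStableAction`
(hopping expansion of the Wilson–Dirac determinant).  The statement evaluates the determinant on
the `U(3)`-valued configuration `apLift U` (the `SU(3)` links of `U` with the links leaving the
slices `x_μ = -1` negated: antiperiodic quark boundary conditions), in the defining representation
`unitaryFundamentalRep (Fin 3) ℂ`, but measures the gauge field by the Wilson action of `U` itself.
This file supplies the bookkeeping between the two: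

* `coe_apLift` : as a matrix, `apLift U e = σ(e) • U e` with the seam sign `σ(e) = ±1` (written
  inline as an `if`; no definitions are introduced);
* `coe_plaquetteHolonomy_apLift` : the seam signs cancel around every plaquette (`μ ≠ ν`), so the
  plaquette matrices of `apLift U` are those of `U`; hence `wilsonAction_apLift` :
  `S_W(apLift U) = S_W(U)` (defining representations on both sides);
* `plaquetteHolonomy_apLift_one`, `hol_apLift_one` : the lift `apLift 1` of the trivial field is a
  flat `ℤ₂` connection — all its plaquettes are `1`, hence (algebraic Stokes theorem `exists_stokes`
  with the discrete length `g ↦ [g ≠ 1]`) its holonomy along every *balanced* word is `1`;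
* `defect_le_two_mul`, `wilsonAction_le_card` : the a-priori bound `S_W(V) ≤ 2N · #plaquettes` for a
  unitary representation.

Mathlib + the sibling `…SmallHoppingDiamagnetism{Defs,Paths,Stokes,Deficit,Words}` files only.
-/

noncomputable section

namespace Summit.QuantumFields.QCD.Theorems.SmallHopping

open Literature.Probability.LatticeModels Literature.MathematicalPhysics.QuantumLattice
  Literature.MathematicalPhysics.QuantumFieldTheory Matrix

variable {L : ℕ}

/-! ## Seam signs and the matrix entries of the lift -/

/-- **Matrix entries of the lift**: `apLift U e = σ(e) • U e` as a `3 × 3` matrix, with the seam sign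
`σ(e) = -1` if the edge `e = (x, μ)` leaves the slice `x_μ = -1` and `+1` otherwise. -/
theorem coe_apLift (U : GaugeConfig 4 L (Matrix.specialUnitaryGroup (Fin 3) ℂ))
    (x : TorusSite 4 L) (μ : Fin 4) :
    ((apLift U (x, μ) : Matrix.unitaryGroup (Fin 3) ℂ) : Matrix (Fin 3) (Fin 3) ℂ) =
      (if x μ = -1 then (-1 : ℂ) else 1) •
        ((U (x, μ) : Matrix.specialUnitaryGroup (Fin 3) ℂ) : Matrix (Fin 3) (Fin 3) ℂ) := by
  unfold apLift
  dsimp only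
  split_ifs with h
  · rw [Unitary.coe_neg, neg_smul, one_smul]
  · rw [one_smul]

/-- The inverse of a lifted link as a matrix: `(apLift U e)⁻¹ = σ(e) • star (U e)`. -/
theorem coe_apLift_inv (U : GaugeConfig 4 L (Matrix.specialUnitaryGroup (Fin 3) ℂ))
    (x : TorusSite 4 L) (μ : Fin 4) :
    (((apLift U (x, μ))⁻¹ : Matrix.unitaryGroup (Fin 3) ℂ) : Matrix (Fin 3) (Fin 3) ℂ) =
      (if x μ = -1 then (-1 : ℂ) else 1) •
        star ((U (x, μ) : Matrix.specialUnitaryGroup (Fin 3) ℂ) : Matrix (Fin 3) (Fin 3) ℂ) := by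
  rw [Matrix.UnitaryGroup.inv_val, coe_apLift, star_smul]
  congr 1
  split_ifs <;> simp

/-! ## Plaquettes of the lift -/

/-- Shifting a site in direction `ν ≠ μ` does not change its `μ`-th coordinate. -/
theorem shift_apply_of_ne {μ ν : Fin 4} (hμν : μ ≠ ν) (x : TorusSite 4 L) :
    (Literature.MathematicalPhysics.QuantumFieldTheory.Site.shift x ν) μ = x μ := by
  unfold Literature.MathematicalPhysics.QuantumFieldTheory.Site.shift
  simp [hμν]

/-- **The seam signs cancel around a plaquette**: for `μ ≠ ν` the plaquette matrix of the lift is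
the plaquette matrix of `U`. -/
theorem coe_plaquetteHolonomy_apLift (U : GaugeConfig 4 L (Matrix.specialUnitaryGroup (Fin 3) ℂ))
    (x : TorusSite 4 L) {μ ν : Fin 4} (hμν : μ ≠ ν) :
    ((plaquetteHolonomy (apLift U) x μ ν : Matrix.unitaryGroup (Fin 3) ℂ) : Matrix (Fin 3) (Fin 3) ℂ) =
      ((plaquetteHolonomy U x μ ν : Matrix.specialUnitaryGroup (Fin 3) ℂ) : Matrix (Fin 3) (Fin 3) ℂ) := by
  simp only [plaquetteHolonomy, Submonoid.coe_mul, coe_apLift_inv, coe_apLift,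
    shift_apply_of_ne hμν, shift_apply_of_ne (Ne.symm hμν)]
  rw [← Matrix.star_eq_inv, ← Matrix.star_eq_inv, Matrix.specialUnitaryGroup.coe_star,
    Matrix.specialUnitaryGroup.coe_star]
  split_ifs <;> simp only [neg_one_smul, one_smul, neg_mul, mul_neg, neg_neg]

/-- **The Wilson actions agree**: `S_W(apLift U)` in the defining representation of `U(3)` is
`S_W(U)` in the defining representation of `SU(3)`. -/
theorem wilsonAction_apLift [NeZero L] (U : GaugeConfig 4 L (Matrix.specialUnitaryGroup (Fin 3) ℂ)) :
    wilsonAction (unitaryFundamentalRep (Fin 3) ℂ) (apLift U) = wilsonAction (fundamentalRep (Fin 3)) U := by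
  unfold wilsonAction
  refine Finset.sum_congr rfl fun p _ => ?_
  rw [unitaryFundamentalRep_apply, fundamentalRep_apply, coe_plaquetteHolonomy_apLift U p.1 (ne_of_lt p.2.2)]

/-! ## The lift of the trivial field is flat -/

/-- Every link of `apLift 1` is a sign: `± 1`. -/
theorem apLift_one_apply (e : Edge 4 L) :
    apLift (1 : GaugeConfig 4 L (Matrix.specialUnitaryGroup (Fin 3) ℂ)) e = 1 ∨
      apLift (1 : GaugeConfig 4 L (Matrix.specialUnitaryGroup (Fin 3) ℂ)) e = -1 := by
  unfold apLift
  split_ifs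
  · right; rfl
  · left; rfl

/-- **All plaquettes of `apLift 1` are trivial** (the seam signs cancel; parallel directions are
trivial for every field). -/
theorem plaquetteHolonomy_apLift_one (x : TorusSite 4 L) (μ ν : Fin 4) :
    plaquetteHolonomy (apLift (1 : GaugeConfig 4 L (Matrix.specialUnitaryGroup (Fin 3) ℂ))) x μ ν = 1 := by
  by_cases hμν : μ = ν
  · subst hμν
    simp only [plaquetteHolonomy, mul_inv_cancel_right, mul_inv_cancel]
  · apply Subtype.ext
    rw [coe_plaquetteHolonomy_apLift _ x hμν]
    simp [plaquetteHolonomy]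

/-- The discrete length `g ↦ [g ≠ 1]` on a group: subadditive, conjugation and inversion invariant,
zero at `1` — an admissible length for the algebraic Stokes theorem `exists_stokes`. -/
theorem discreteLength_props {G : Type*} [Group G] [DecidableEq G] :
    (∀ g h : G, (if g * h = 1 then (0 : ℝ) else 1) ≤ (if g = 1 then 0 else 1) + (if h = 1 then 0 else 1)) ∧
    (∀ c g : G, (if c * g * c⁻¹ = 1 then (0 : ℝ) else 1) = (if g = 1 then 0 else 1)) ∧
    (∀ g : G, (if g⁻¹ = 1 then (0 : ℝ) else 1) = (if g = 1 then 0 else 1)) ∧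
    ((if (1 : G) = 1 then (0 : ℝ) else 1) = 0) := by
  refine ⟨fun g h => ?_, fun c g => ?_, fun g => ?_, by simp⟩
  · by_cases hg : g = 1 <;> by_cases hh : h = 1 <;> simp [hg, hh]
    split_ifs <;> norm_num
  · have : c * g * c⁻¹ = 1 ↔ g = 1 := by
      rw [mul_inv_eq_one, mul_eq_left]
    simp only [this]
  · simp only [inv_eq_one]

/-- **Holonomies of `apLift 1` along balanced words are trivial.**  (`apLift 1` is a flat
`ℤ₂`-connection: by the algebraic Stokes theorem with the discrete length, the length of the
holonomy of a balanced word is bounded by a sum of plaquette lengths, all zero.) -/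
theorem hol_apLift_one (x : TorusSite 4 L) (w : List Letter) (hw : balanced w = true) :
    hol (apLift (1 : GaugeConfig 4 L (Matrix.specialUnitaryGroup (Fin 3) ℂ))) x w = 1 := by
  classical
  obtain ⟨hmul, hconj, hinv, hone⟩ :=
    discreteLength_props (G := Matrix.unitaryGroup (Fin 3) ℂ)
  obtain ⟨P, -, hP⟩ := exists_stokes (L := L) (fun g : Matrix.unitaryGroup (Fin 3) ℂ => if g = 1 then (0 : ℝ) else 1)
    hmul hconj hinv hone w.length w le_rfl hw
  have h := hP (apLift 1) x
  simp only [plaquetteHolonomy_apLift_one, if_true, List.map_const', List.sum_replicate, smul_zero] at h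
  by_contra hne
  rw [if_neg hne] at h
  exact absurd h (by norm_num)

/-! ## A-priori bound on the Wilson action -/

section Bound

variable {N : ℕ} {G : Type*} [Group G] (ρ : G →* Matrix (Fin N) (Fin N) ℂ)
  (hρ : ∀ g, ρ g ∈ Matrix.unitaryGroup (Fin N) ℂ)
include hρ

/-- Entries of a unitary matrix have modulus `≤ 1`. -/
theorem norm_apply_le_one_of_unitary (g : G) (i j : Fin N) : ‖ρ g i j‖ ≤ 1 := by
  have h := Matrix.mem_unitaryGroup_iff.mp (hρ g)
  -- row `i` of `ρ g` has unit `ℓ²` norm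
  have hrow : ∑ k, ‖ρ g i k‖ ^ 2 = 1 := by
    have h1 := congrFun (congrFun h i) i
    rw [Matrix.mul_apply, Matrix.one_apply_eq] at h1
    have h2 : ∀ k, ρ g i k * star (ρ g) k i = ((‖ρ g i k‖ ^ 2 : ℝ) : ℂ) := fun k => by
      rw [Matrix.star_apply, Complex.star_def, Complex.mul_conj, Complex.normSq_eq_norm_sq]
    simp_rw [h2] at h1
    exact_mod_cast h1
  have hle : ‖ρ g i j‖ ^ 2 ≤ 1 := by
    rw [← hrow]
    exact Finset.single_le_sum (f := fun k => ‖ρ g i k‖ ^ 2) (fun k _ => by positivity)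
      (Finset.mem_univ j)
  nlinarith [norm_nonneg (ρ g i j)]

/-- The deficit of a unitary matrix is at most `2N`: `N - Re tr ρ(g) ≤ 2N`. -/
theorem defect_le_two_mul (g : G) : defect ρ g ≤ 2 * N := by
  unfold defect
  have h : |(ρ g).trace.re| ≤ N := by
    calc |(ρ g).trace.re| ≤ ‖(ρ g).trace‖ := Complex.abs_re_le_norm _
      _ ≤ ∑ i, ‖ρ g i i‖ := by
          rw [Matrix.trace]; exact norm_sum_le _ _
      _ ≤ ∑ _i : Fin N, (1 : ℝ) := Finset.sum_le_sum fun i _ => norm_apply_le_one_of_unitary ρ hρ g i i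
      _ = N := by simp
  have := neg_abs_le (ρ g).trace.re
  linarith

/-- **A-priori bound**: `S_W(V) ≤ 2N · #plaquettes = 2N · 6 · L⁴` on the four-torus of side `L`. -/
theorem wilsonAction_le_card [NeZero L] (V : GaugeConfig 4 L G) :
    wilsonAction ρ V ≤ 2 * N * (6 * (L : ℝ) ^ 4) := by
  unfold wilsonAction
  have hcard : (Fintype.card (Plaquette 4 L) : ℝ) = 6 * (L : ℝ) ^ 4 := by
    rw [Fintype.card_prod, Fintype.card_pi, Finset.prod_const, ZMod.card, Finset.card_univ,
      Fintype.card_fin, Fintype.card_subtype]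
    have : (Finset.univ.filter fun p : Fin 4 × Fin 4 => p.1 < p.2).card = 6 := by decide
    rw [this]; push_cast; ring
  calc ∑ p : Plaquette 4 L, ((N : ℝ) - (ρ (plaquetteHolonomy V p.1 p.2.1.1 p.2.1.2)).trace.re)
      ≤ ∑ _p : Plaquette 4 L, (2 * N : ℝ) := Finset.sum_le_sum fun p _ => defect_le_two_mul ρ hρ _
    _ = 2 * N * (6 * (L : ℝ) ^ 4) := by
        rw [Finset.sum_const, Finset.card_univ, nsmul_eq_mul, hcard]; ring

end Bound

end Summit.QuantumFields.QCD.Theorems.SmallHopping
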